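import Summits.NavierStokesRegularity.NavierStokesRegularity.Theorems.WakeRatchetExtractionFrameLip

/-!
# WakeRatchetExtractionAction — LINE g9-1 «clocked frames», part 4/7: ⟨22744⟩ `WakeRatchet.MinimalBlowupExtraction`

Ideator ns-idea-1 g9, LINE g9-1 «clocked frames» (critic of record idea-crit-3): part 4 of 7 of the split landing kit of
`extraction_proved.lean` (sha16 849d037365163546, the sorry-free proof of route item ⟨stmt-NavierStokesRegularity-22744⟩
`WakeRatchet.MinimalBlowupExtraction`), cut at the author's seams with every declaration VERBATIM; parts chain by import
(1 Ascoli → 2 Frames → 3 FrameLip → 4 Action → 5 Law → 6 Clock → 7 MinimalBlowupExtraction).  MODEL lattice only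
(Tao 2016 averaged Navier–Stokes cascade); no summit is proved by a line — part 7 closes ONE crux (K2) of route WakeRatchet.

This part: Closure inputs (pointwise bound, far-tail envelope, window action of the frames), the closure split
`StubClosure ⇐ ClosureLaw ∧ ClosureAction`, the limit lemmas (bound, envelope, Lipschitz, continuity of the limit) and
`closureAction_holds : ClosureAction` (change of variables `t = T − e^{−σ}`, improper integrals, Fatou).
-/

noncomputable section

set_option linter.dupNamespace false

namespace Summit.NavierStokesRegularity.NavierStokesRegularity.Cruxes.MinimalBlowupExtraction.ClockedFrames

open Set Filter Topology MeasureTheory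
open scoped RealInnerProductSpace
open Literature.Analysis.FluidPDE Literature.Analysis.FluidPDE.TaoCascade
open Summit.NavierStokesRegularity.NavierStokesRegularity.Cruxes.MinimalBlowupExtraction.Extraction
  (exists_subseq_continuousLimit_param)
open Summit.NavierStokesRegularity.NavierStokesRegularity.Theorems.DSSOneShift
  (hasDerivWithinAt_shellVec bigLam_zpow_eq_rpow)
open Summit.NavierStokesRegularity.NavierStokesRegularity.Theorems.WakeRatchetCritical
  (tableQ_smul tableA_smul tableB_smul_smul continuous_tableB)
open Summit.NavierStokesRegularity.NavierStokesRegularity.Theorems.TransitMassLedgerEnergy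
  (continuous_tableQ continuous_tableA continuous_tableB_comp)
open Summit.NavierStokesRegularity.NavierStokesRegularity.Cruxes.MinimalBlowupExtraction.TableCont

variable {ε₀ : ℝ} {α : Fin 4 → Fin 4 → Fin 4 → ℤ × ℤ × ℤ → ℝ} {X₀ : Fin 4 → ℝ} {ν T C c : ℝ}
  {X : Fin 4 → ℤ → ℝ → ℝ} {c' κ₁ κ₂ : ℝ} {τ : ℕ → ℝ}


/-- **(e)** On its window a clocked frame is bounded by the type-I constant (explicit form of E1a). -/
theorem norm_frame_le (hP : Pinned ε₀ α X₀ ν T C c X) (hε : 0 < ε₀) (hclk : ClockedFiring ε₀ T c' κ₁ κ₂ X τ)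
    (j : ℕ) (n : ℤ) {u : ℝ} (hwin : Real.exp (-u) * (T - τ j) < T) :
    ‖frame ε₀ T X j (-Real.log (T - τ j)) n u‖ ≤ C := by
  obtain ⟨hν, hT, hc, hcd, hX0, hneg, hlaw, htypeI, hint, hpin, hfire⟩ := hP
  have gj : 0 < T - τ j := by linarith [(hclk j).2.1]
  have hepos : 0 < Real.exp (-u) * (T - τ j) := mul_pos (Real.exp_pos _) gj
  have hL : 0 < bigLam ε₀ ^ (n + (j : ℤ)) := zpow_pos (bigLam_pos (by linarith)) _
  simp only [frame, renorm]
  rw [exp_shift gj, norm_smul, Real.norm_of_nonneg (mul_pos hL hepos).le]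
  have hI := htypeI (n + (j : ℤ)) (T - Real.exp (-u) * (T - τ j)) (by linarith) (by linarith)
  rw [sub_sub_cancel] at hI
  exact hI

/-- **(d)** The far-tail envelope of the frames, uniformly in `j`: `e^{2u} ‖F_n(u)‖² ≤ C κ₂² (1+ε₀)^{4n}`
(energy pinning `(1+ε₀)^k ‖X_k‖² ≤ C` at `k = n + j` and the upper clock `T − τ_j ≤ κ₂ (1+ε₀)^{-2j}`). -/
theorem frame_envelope (hP : Pinned ε₀ α X₀ ν T C c X) (hε : 0 < ε₀) (hclk : ClockedFiring ε₀ T c' κ₁ κ₂ X τ)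
    (j : ℕ) (n : ℤ) {u : ℝ} (hwin : Real.exp (-u) * (T - τ j) < T) :
    Real.exp (2 * u) * ‖frame ε₀ T X j (-Real.log (T - τ j)) n u‖ ^ 2 ≤ C * κ₂ ^ 2 * (1 + ε₀) ^ (4 * n) := by
  obtain ⟨hν, hT, hc, hcd, hX0, hneg, hlaw, htypeI, hint, hpin, hfire⟩ := hP
  have hb : (0 : ℝ) < 1 + ε₀ := by linarith
  have hΛ : 0 < bigLam ε₀ := bigLam_pos (by linarith)
  have gj : 0 < T - τ j := by linarith [(hclk j).2.1]
  obtain ⟨-, -, -, hup, -⟩ := hclk j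
  have hepos : 0 < Real.exp (-u) * (T - τ j) := mul_pos (Real.exp_pos _) gj
  simp only [frame, renorm]
  rw [exp_shift gj, norm_smul, Real.norm_of_nonneg (mul_pos (zpow_pos hΛ _) hepos).le]
  set k : ℤ := n + (j : ℤ) with hk
  set g := T - τ j with hg
  set t := T - Real.exp (-u) * g with ht
  have ht0 : 0 ≤ t := by rw [ht]; linarith
  have htT : t < T := by rw [ht]; linarith
  set L := bigLam ε₀ ^ k with hLdef
  have hL : 0 < L := zpow_pos hΛ k
  set a := ‖shellVec X k t‖ with ha
  have ha0 : 0 ≤ a := norm_nonneg _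
  set P := (1 + ε₀) ^ (2 * j) with hPdef
  have hP0 : 0 < P := pow_pos hb _
  -- e^{2u} (L e^{-u} g a)² = (L g a)²
  have hee : Real.exp (-u) * Real.exp u = 1 := by rw [← Real.exp_add]; simp
  have e0 : Real.exp (2 * u) * (L * (Real.exp (-u) * g) * a) ^ 2 = (L * g * a) ^ 2 := by
    rw [two_mul, Real.exp_add]
    calc Real.exp u * Real.exp u * (L * (Real.exp (-u) * g) * a) ^ 2
        = (Real.exp (-u) * Real.exp u) ^ 2 * (L * g * a) ^ 2 := by ring
      _ = (L * g * a) ^ 2 := by rw [hee]; ring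
  rw [e0]
  -- pinning and clock
  have hpk : (1 + ε₀) ^ k * a ^ 2 ≤ C := hpin k t ht0 htT
  have h1 : (L * g * a) ^ 2 ≤ (L * (κ₂ * P⁻¹) * a) ^ 2 :=
    pow_le_pow_left₀ (by positivity)
      (mul_le_mul_of_nonneg_right (mul_le_mul_of_nonneg_left hup hL.le) ha0) 2
  -- the scalar algebra: L² = (1+ε₀)^{4n} P² (1+ε₀)^k
  have hL2 : L ^ 2 = (1 + ε₀) ^ (4 * n) * P ^ 2 * (1 + ε₀) ^ k := by
    have s1 : L ^ 2 = (1 + ε₀) ^ (5 * k) := by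
      rw [hLdef, ← zpow_natCast (bigLam ε₀ ^ k) 2, ← zpow_mul, mul_comm, zpow_mul, zpow_natCast,
        bigLam_sq (by linarith : (0 : ℝ) ≤ ε₀), ← zpow_natCast (1 + ε₀) 5, ← zpow_mul]
      norm_num
    have s2 : P ^ 2 = (1 + ε₀) ^ ((4 * j : ℕ) : ℤ) := by
      rw [hPdef, ← pow_mul, zpow_natCast]; congr 1; ring
    rw [s1, s2, ← zpow_add₀ hb.ne', ← zpow_add₀ hb.ne']
    congr 1; rw [hk]; push_cast; ring
  have key : (L * (κ₂ * P⁻¹) * a) ^ 2 = κ₂ ^ 2 * (1 + ε₀) ^ (4 * n) * ((1 + ε₀) ^ k * a ^ 2) := by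
    rw [show (L * (κ₂ * P⁻¹) * a) ^ 2 = L ^ 2 * (κ₂ ^ 2 * (P⁻¹) ^ 2 * a ^ 2) by ring, hL2]
    field_simp
  rw [key] at h1
  have h4n : 0 ≤ κ₂ ^ 2 * (1 + ε₀) ^ (4 * n) := by positivity
  calc (L * g * a) ^ 2 ≤ κ₂ ^ 2 * (1 + ε₀) ^ (4 * n) * ((1 + ε₀) ^ k * a ^ 2) := h1
    _ ≤ κ₂ ^ 2 * (1 + ε₀) ^ (4 * n) * C := mul_le_mul_of_nonneg_left hpk h4n
    _ = C * κ₂ ^ 2 * (1 + ε₀) ^ (4 * n) := by ring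

/-- Shell vectors are continuous on `[0,T)`. -/
theorem continuousOn_shellVec (hP : Pinned ε₀ α X₀ ν T C c X) (k : ℤ) :
    ContinuousOn (shellVec X k) (Ico 0 T) := by
  obtain ⟨-, -, -, hcd, -⟩ := hP
  have hc : ContinuousOn (fun t => fun i => X i k t) (Ico 0 T) :=
    continuousOn_pi.2 fun i => (hcd i k).continuousOn
  have h := (PiLp.continuous_toLp 2 (fun _ : Fin 4 => ℝ)).comp_continuousOn hc
  exact h

/-- **(c)** The action of a frame over any finite piece `[a,b]` of its window is at most the type-I action
constant: `∫_a^b ‖F_n‖ du = Λ^k ∫_{t(a)}^{t(b)} ‖X_k‖ dt ≤ Λ^k ∫_{[0,T)} ‖X_k‖ ≤ C` (substitution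
`t = T − e^{-u}(T − τ_j)`, `dt = e^{-u}(T − τ_j) du`). -/
theorem frame_action (hP : Pinned ε₀ α X₀ ν T C c X) (hε : 0 < ε₀) (hclk : ClockedFiring ε₀ T c' κ₁ κ₂ X τ)
    (j : ℕ) (n : ℤ) {a b : ℝ} (hab : a ≤ b) (hwin : Real.exp (-a) * (T - τ j) < T) :
    ∫ u in a..b, ‖frame ε₀ T X j (-Real.log (T - τ j)) n u‖ ≤ C := by
  have hP' := hP
  obtain ⟨hν, hT, hc, hcd, hX0, hneg, hlaw, htypeI, hint, hpin, hfire⟩ := hP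
  have hΛ : 0 < bigLam ε₀ := bigLam_pos (by linarith)
  have gj : 0 < T - τ j := by linarith [(hclk j).2.1]
  have hL : 0 < bigLam ε₀ ^ (n + (j : ℤ)) := zpow_pos hΛ _
  -- the substitution `θ u = T − e^{-u}(T − τ_j)`
  have hθ' : ∀ u : ℝ, HasDerivAt (fun v => T - Real.exp (-v) * (T - τ j)) (Real.exp (-u) * (T - τ j)) u := by
    intro u
    have h1 : HasDerivAt (fun v => Real.exp (-v)) (-Real.exp (-u)) u := by
      have h := (hasDerivAt_neg u).exp
      simpa using h
    have h2 := (h1.mul_const (T - τ j)).const_sub T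
    simpa using h2
  have hθlow : ∀ u : ℝ, a ≤ u → 0 < T - Real.exp (-u) * (T - τ j) := by
    intro u hu
    have h1 : Real.exp (-u) ≤ Real.exp (-a) := Real.exp_le_exp.2 (by linarith)
    have h2 := mul_le_mul_of_nonneg_right h1 gj.le
    linarith
  have hθT : ∀ u : ℝ, T - Real.exp (-u) * (T - τ j) < T := fun u => by
    linarith [mul_pos (Real.exp_pos (-u)) gj]
  have hθmono : ∀ u v : ℝ, u ≤ v → T - Real.exp (-u) * (T - τ j) ≤ T - Real.exp (-v) * (T - τ j) := by
    intro u v huv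
    have h1 : Real.exp (-v) ≤ Real.exp (-u) := Real.exp_le_exp.2 (by linarith)
    have h2 := mul_le_mul_of_nonneg_right h1 gj.le
    linarith
  -- the integrand is `(g ∘ θ) · θ'` with `g t = Λ^k ‖X_k(t)‖`
  have heq : ∫ u in a..b, ‖frame ε₀ T X j (-Real.log (T - τ j)) n u‖ =
      ∫ u in a..b, ((fun t => bigLam ε₀ ^ (n + (j : ℤ)) * ‖shellVec X (n + (j : ℤ)) t‖) ∘
          (fun v => T - Real.exp (-v) * (T - τ j))) u * (Real.exp (-u) * (T - τ j)) := by
    refine intervalIntegral.integral_congr fun u _ => ?_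
    simp only [Function.comp, frame, renorm]
    rw [exp_shift gj, norm_smul, Real.norm_of_nonneg (mul_pos hL (mul_pos (Real.exp_pos _) gj)).le]
    ring
  have hsub : (fun v => T - Real.exp (-v) * (T - τ j)) '' (uIcc a b) ⊆ Ico 0 T := by
    rintro _ ⟨u, hu, rfl⟩
    rw [uIcc_of_le hab] at hu
    exact ⟨(hθlow u hu.1).le, hθT u⟩
  have hg : ContinuousOn (fun t => bigLam ε₀ ^ (n + (j : ℤ)) * ‖shellVec X (n + (j : ℤ)) t‖)
      ((fun v => T - Real.exp (-v) * (T - τ j)) '' (uIcc a b)) :=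
    (continuousOn_const.mul (continuousOn_shellVec hP' (n + (j : ℤ))).norm).mono hsub
  have hkey := intervalIntegral.integral_comp_mul_deriv' (a := a) (b := b) (fun u _ => hθ' u)
    (((Real.continuous_exp.comp continuous_neg).mul continuous_const).continuousOn) hg
  rw [heq, hkey, intervalIntegral.integral_of_le (hθmono a b hab), integral_const_mul]
  -- compare with the action over `[0,T)`
  have hIoc : Ioc (T - Real.exp (-a) * (T - τ j)) (T - Real.exp (-b) * (T - τ j)) ⊆ Ico 0 T :=
    fun t ht => ⟨(hθlow a le_rfl).le.trans ht.1.le, lt_of_le_of_lt ht.2 (hθT b)⟩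
  have hmono : ∫ t in Ioc (T - Real.exp (-a) * (T - τ j)) (T - Real.exp (-b) * (T - τ j)),
      ‖shellVec X (n + (j : ℤ)) t‖ ≤ ∫ t in Ico 0 T, ‖shellVec X (n + (j : ℤ)) t‖ :=
    setIntegral_mono_set (hint (n + (j : ℤ))).1 (ae_of_all _ fun t => norm_nonneg _)
      (ae_of_all _ hIoc)
  calc bigLam ε₀ ^ (n + (j : ℤ)) *
        ∫ t in Ioc (T - Real.exp (-a) * (T - τ j)) (T - Real.exp (-b) * (T - τ j)), ‖shellVec X (n + (j : ℤ)) t‖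
      ≤ bigLam ε₀ ^ (n + (j : ℤ)) * ∫ t in Ico 0 T, ‖shellVec X (n + (j : ℤ)) t‖ :=
        mul_le_mul_of_nonneg_left hmono hL.le
    _ ≤ C := (hint (n + (j : ℤ))).2

/-! ## The closure step split: `StubClosure ⇐ ClosureLaw ∧ ClosureAction`
(the bound (e), the envelope (d) and the sign of `ν̂` pass to the continuous limit HERE; what is left is the
passage of the exact law (a) and of the window action (c) to the limit) -/

/-- CLOSURE, LAW HALF: the continuous limit of the clocked frames solves the renormalised viscous law with the
limiting covariant viscosity `ν̂ = lim viscParam (φ j)` (integral form of `frame_law` under local uniform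
convergence — continuous convergence + the equi-Lipschitz bound E1b — and `viscParam (φ j) → ν̂`). -/
def ClosureLaw : Prop :=
  ∀ (ε₀ R : ℝ) (α : Fin 4 → Fin 4 → Fin 4 → ℤ × ℤ × ℤ → ℝ) (X₀ : Fin 4 → ℝ) (ν T C c : ℝ)
    (X : Fin 4 → ℤ → ℝ → ℝ), 0 < ε₀ → InTableClass R α → Pinned ε₀ α X₀ ν T C c X →
    ∀ (c' κ₁ κ₂ : ℝ) (τ : ℕ → ℝ), 0 < κ₁ → ClockedFiring ε₀ T c' κ₁ κ₂ X τ →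
      ∀ (φ : ℕ → ℕ) (W : ℤ → ℝ → Em 4) (νh : ℝ), StrictMono φ → νh ∈ Icc (ν * κ₁) (ν * κ₂) →
        Tendsto (fun j => viscParam ε₀ ν T τ (φ j)) atTop (𝓝 νh) → FramesConverge ε₀ T X τ φ W →
        ∀ (n : ℤ) (σ : ℝ), HasDerivAt (W n)
          (-((1 : ℝ) • W n σ) + tableQ α (W n σ) + bigLam ε₀ • tableA α (W (n - 1) σ)
            + (bigLam ε₀)⁻¹ • tableB α (W (n + 1) σ) (W n σ)
            - (νh * ((1 + ε₀) ^ ((2 : ℝ) * n) * Real.exp (-σ))) • W n σ) σ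

/-- CLOSURE, ACTION HALF: the continuous limit has uniformly bounded per-shell action on `ℝ`
(Fatou / monotone windows on `frame_action`: `∫_a^b ‖F_n‖ ≤ C` for every finite piece of every window). -/
def ClosureAction : Prop :=
  ∀ (ε₀ R : ℝ) (α : Fin 4 → Fin 4 → Fin 4 → ℤ × ℤ × ℤ → ℝ) (X₀ : Fin 4 → ℝ) (ν T C c : ℝ)
    (X : Fin 4 → ℤ → ℝ → ℝ), 0 < ε₀ → InTableClass R α → Pinned ε₀ α X₀ ν T C c X →
    ∀ (c' κ₁ κ₂ : ℝ) (τ : ℕ → ℝ), 0 < κ₁ → ClockedFiring ε₀ T c' κ₁ κ₂ X τ →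
      ∀ (φ : ℕ → ℕ) (W : ℤ → ℝ → Em 4) (νh : ℝ), StrictMono φ → νh ∈ Icc (ν * κ₁) (ν * κ₂) →
        Tendsto (fun j => viscParam ε₀ ν T τ (φ j)) atTop (𝓝 νh) → FramesConverge ε₀ T X τ φ W →
        ∃ M : ℝ, ∀ n : ℤ, Integrable (fun σ => ‖W n σ‖) ∧ ∫ σ, ‖W n σ‖ ≤ M

section Limit

variable {τ : ℕ → ℝ} {φ : ℕ → ℕ} {W : ℤ → ℝ → Em 4} {c' κ₁ κ₂ : ℝ}

/-- Pointwise convergence of the frames along `φ` (constant argument sequence). -/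
theorem limit_pointwise (hconv : FramesConverge ε₀ T X τ φ W) (n : ℤ) (σ : ℝ) :
    Tendsto (fun j => frame ε₀ T X (φ j) (-Real.log (T - τ (φ j))) n σ) atTop (𝓝 (W n σ)) :=
  hconv n (fun _ => σ) σ tendsto_const_nhds

/-- Along a subsequence the windows still open eventually. -/
theorem eventually_window_sub (hε : 0 < ε₀) (hT : 0 < T) (hclk : ClockedFiring ε₀ T c' κ₁ κ₂ X τ)
    (hφ : StrictMono φ) (a : ℝ) : ∀ᶠ j in atTop, Real.exp (-a) * (T - τ (φ j)) < T := by
  obtain ⟨J, hJ⟩ := eventually_window hε hT hclk a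
  exact eventually_atTop.2 ⟨J, fun j hj => hJ (φ j) (hj.trans (hφ.id_le j))⟩

/-- **(e) in the limit**: `‖W_n(σ)‖ ≤ C`. -/
theorem limit_norm_le (hP : Pinned ε₀ α X₀ ν T C c X) (hε : 0 < ε₀) (hclk : ClockedFiring ε₀ T c' κ₁ κ₂ X τ)
    (hφ : StrictMono φ) (hconv : FramesConverge ε₀ T X τ φ W) (n : ℤ) (σ : ℝ) : ‖W n σ‖ ≤ C :=
  le_of_tendsto (limit_pointwise hconv n σ).norm
    ((eventually_window_sub hε hP.2.1 hclk hφ σ).mono fun j hj => norm_frame_le hP hε hclk (φ j) n hj)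

/-- **(d) in the limit**: `e^{2σ} ‖W_n(σ)‖² ≤ C κ₂² (1+ε₀)^{4n}` for every `σ`. -/
theorem limit_envelope (hP : Pinned ε₀ α X₀ ν T C c X) (hε : 0 < ε₀) (hclk : ClockedFiring ε₀ T c' κ₁ κ₂ X τ)
    (hφ : StrictMono φ) (hconv : FramesConverge ε₀ T X τ φ W) (n : ℤ) (σ : ℝ) :
    Real.exp (2 * σ) * ‖W n σ‖ ^ 2 ≤ C * κ₂ ^ 2 * (1 + ε₀) ^ (4 * n) :=
  le_of_tendsto ((((limit_pointwise hconv n σ).norm).pow 2).const_mul (Real.exp (2 * σ)))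
    ((eventually_window_sub hε hP.2.1 hclk hφ σ).mono fun j hj => frame_envelope hP hε hclk (φ j) n hj)

/-- Explicit form of E1b: the frames are `lipK`-Lipschitz on `[a, ∞)` once the window has opened. -/
theorem frame_lipschitz (hP : Pinned ε₀ α X₀ ν T C c X) (hε : 0 < ε₀) (hclk : ClockedFiring ε₀ T c' κ₁ κ₂ X τ)
    (j : ℕ) (n : ℤ) {a u v : ℝ} (hu : a ≤ u) (hv : a ≤ v) (hwin : Real.exp (-a) * (T - τ j) < T) :
    ‖frame ε₀ T X j (-Real.log (T - τ j)) n u - frame ε₀ T X j (-Real.log (T - τ j)) n v‖ ≤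
      lipK α ν C ε₀ κ₂ n a * |u - v| := by
  have gj : 0 < T - τ j := by linarith [(hclk j).2.1]
  have hwin' : ∀ w : ℝ, a ≤ w → Real.exp (-(w + -Real.log (T - τ j))) < T := by
    intro w hw
    rw [exp_shift gj]
    have h1 : Real.exp (-w) ≤ Real.exp (-a) := Real.exp_le_exp.2 (by linarith)
    have h2 := mul_le_mul_of_nonneg_right h1 gj.le
    linarith
  have h := Convex.norm_image_sub_le_of_norm_hasDerivWithin_le
    (f := fun w => frame ε₀ T X j (-Real.log (T - τ j)) n w) (s := Ici a) (x := v) (y := u)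
    (fun w hw => (hasDerivAt_frame hP j n (-Real.log (T - τ j)) (hwin' w hw)).hasDerivWithinAt)
    (fun w hw => norm_frameDeriv_le hP hε hclk j n hw hwin) (convex_Ici a) hv hu
  simpa only [Real.norm_eq_abs] using h

/-- **E1b in the limit**: `W_n` is `lipK(n,a)`-Lipschitz on every half-line `[a, ∞)`. -/
theorem limit_lipschitz (hP : Pinned ε₀ α X₀ ν T C c X) (hε : 0 < ε₀) (hclk : ClockedFiring ε₀ T c' κ₁ κ₂ X τ)
    (hφ : StrictMono φ) (hconv : FramesConverge ε₀ T X τ φ W) (n : ℤ) {a u v : ℝ} (hu : a ≤ u) (hv : a ≤ v) :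
    ‖W n u - W n v‖ ≤ lipK α ν C ε₀ κ₂ n a * |u - v| :=
  le_of_tendsto ((limit_pointwise hconv n u).sub (limit_pointwise hconv n v)).norm
    ((eventually_window_sub hε hP.2.1 hclk hφ a).mono fun j hj => frame_lipschitz hP hε hclk (φ j) n hu hv hj)

/-- Hence every shell of the limit is Lipschitz on half-lines, in particular **continuous** (the measurability /
FTC input of both closure halves). -/
theorem limit_lipschitzOnWith (hP : Pinned ε₀ α X₀ ν T C c X) (hε : 0 < ε₀)
    (hclk : ClockedFiring ε₀ T c' κ₁ κ₂ X τ) (hφ : StrictMono φ) (hconv : FramesConverge ε₀ T X τ φ W) (n : ℤ)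
    (a : ℝ) : LipschitzOnWith (Real.toNNReal (lipK α ν C ε₀ κ₂ n a)) (W n) (Ici a) :=
  LipschitzOnWith.of_dist_le' fun u hu v hv => by
    rw [dist_eq_norm, Real.dist_eq]
    exact limit_lipschitz hP hε hclk hφ hconv n hu hv

/-- The extracted limit frames `W n` are continuous. -/
theorem continuous_limit (hP : Pinned ε₀ α X₀ ν T C c X) (hε : 0 < ε₀) (hclk : ClockedFiring ε₀ T c' κ₁ κ₂ X τ)
    (hφ : StrictMono φ) (hconv : FramesConverge ε₀ T X τ φ W) (n : ℤ) : Continuous (W n) := by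
  refine continuous_iff_continuousAt.2 fun σ => ?_
  exact ((limit_lipschitzOnWith hP hε hclk hφ hconv n (σ - 1)).continuousOn).continuousAt
    (Ici_mem_nhds (by linarith))

end Limit

/-- **ClosureAction PROVED.**  On every finite piece `[a,b]` of the windows the frames are eventually continuous,
bounded by `C` and converge pointwise, so `∫_a^b ‖W_n‖ = lim ∫_a^b ‖F‖ ≤ C` (dominated convergence +
`frame_action`); `W_n` is continuous (`continuous_limit`), hence integrable on `ℝ` with `∫ ‖W_n‖ ≤ C`
(`integrable_of_intervalIntegral_norm_bounded`, `intervalIntegral_tendsto_integral`). -/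
theorem closureAction_holds : ClosureAction := by
  intro ε₀ R α X₀ ν T C c X hε hα hP c' κ₁ κ₂ τ hκ₁ hclk φ W νh hφ hνh hvp hconv
  have hT : 0 < T := hP.2.1
  refine ⟨C, fun n => ?_⟩
  have hcont : Continuous (W n) := continuous_limit hP hε hclk hφ hconv n
  have hcn : Continuous (fun σ => ‖W n σ‖) := hcont.norm
  -- finite pieces of the windows
  have hwin_int : ∀ a b : ℝ, a ≤ b → ∫ u in a..b, ‖W n u‖ ≤ C := by
    intro a b hab
    have hev := eventually_window_sub hε hT hclk hφ a
    have hwu : ∀ j : ℕ, Real.exp (-a) * (T - τ (φ j)) < T → ∀ u : ℝ, a ≤ u →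
        Real.exp (-u) * (T - τ (φ j)) < T := by
      intro j hj u hu
      have gj : 0 < T - τ (φ j) := by linarith [(hclk (φ j)).2.1]
      have h1 : Real.exp (-u) ≤ Real.exp (-a) := Real.exp_le_exp.2 (by linarith)
      have h2 := mul_le_mul_of_nonneg_right h1 gj.le
      linarith
    have hlim : Tendsto (fun j => ∫ u in a..b, ‖frame ε₀ T X (φ j) (-Real.log (T - τ (φ j))) n u‖) atTop
        (𝓝 (∫ u in a..b, ‖W n u‖)) := by
      refine intervalIntegral.tendsto_integral_filter_of_dominated_convergence (fun _ => C) ?_ ?_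
        intervalIntegrable_const ?_
      · refine hev.mono fun j hj => ?_
        refine ContinuousOn.aestronglyMeasurable ?_ measurableSet_uIoc
        intro u hu
        rw [Set.uIoc_of_le hab] at hu
        have gj : 0 < T - τ (φ j) := by linarith [(hclk (φ j)).2.1]
        have hwin' : Real.exp (-(u + -Real.log (T - τ (φ j)))) < T := by
          rw [exp_shift gj]; exact hwu j hj u hu.1.le
        exact ((hasDerivAt_frame hP (φ j) n _ hwin').continuousAt.norm).continuousWithinAt
      · refine hev.mono fun j hj => ae_of_all _ fun u hu => ?_
        rw [Set.uIoc_of_le hab] at hu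
        rw [norm_norm]
        exact norm_frame_le hP hε hclk (φ j) n (hwu j hj u hu.1.le)
      · exact ae_of_all _ fun u _ => (limit_pointwise hconv n u).norm
    exact le_of_tendsto hlim (hev.mono fun j hj => frame_action hP hε hclk (φ j) n hab hj)
  -- integrability on `ℝ` and the total action
  have hfi : ∀ i : ℕ, IntegrableOn (fun σ => ‖W n σ‖) (Ioc (-(i : ℝ)) i) := fun i =>
    (hcn.integrableOn_Icc).mono_set Ioc_subset_Icc_self
  have ha : Tendsto (fun i : ℕ => -(i : ℝ)) atTop atBot :=
    tendsto_neg_atTop_atBot.comp tendsto_natCast_atTop_atTop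
  have hb : Tendsto (fun i : ℕ => (i : ℝ)) atTop atTop := tendsto_natCast_atTop_atTop
  have hii : ∀ i : ℕ, -(i : ℝ) ≤ i := fun i => by
    have h0 : (0 : ℝ) ≤ i := Nat.cast_nonneg i
    linarith
  have hInt : Integrable (fun σ => ‖W n σ‖) := by
    refine integrable_of_intervalIntegral_norm_bounded C hfi ha hb (Eventually.of_forall fun i => ?_)
    simp only [norm_norm]
    exact hwin_int _ _ (hii i)
  exact ⟨hInt, le_of_tendsto' (intervalIntegral_tendsto_integral hInt ha hb) fun i => hwin_int _ _ (hii i)⟩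

/-- **StubClosure from its two analytic halves.**  The admissibility clauses `nonneg`, `bdd` and the
`UniformBound` are discharged here (sign of `ν̂ ≥ νκ₁ > 0`, the limit envelope, the limit bound). -/
theorem stubClosure_of (h₁ : ClosureLaw) (h₂ : ClosureAction) : StubClosure := by
  intro ε₀ R α X₀ ν T C c X hε hα hP c' κ₁ κ₂ τ hκ₁ hclk φ W νh hφ hνh hvp hconv
  have hν : 0 < ν := hP.1
  refine ⟨⟨h₁ ε₀ R α X₀ ν T C c X hε hα hP c' κ₁ κ₂ τ hκ₁ hclk φ W νh hφ hνh hvp hconv, ?_,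
    h₂ ε₀ R α X₀ ν T C c X hε hα hP c' κ₁ κ₂ τ hκ₁ hclk φ W νh hφ hνh hvp hconv, fun n => ?_⟩,
    ⟨C, fun k σ => limit_norm_le hP hε hclk hφ hconv k σ⟩⟩
  · exact ((mul_pos hν hκ₁).trans_le hνh.1).le
  · exact ⟨0, C * κ₂ ^ 2 * (1 + ε₀) ^ (4 * n), fun σ _ => limit_envelope hP hε hclk hφ hconv n σ⟩

/-- Hence the last registered stub from the two halves. -/
theorem stubOmegaLimit_of_law_action (h₁ : ClosureLaw) (h₂ : ClosureAction) : StubOmegaLimit :=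
  stubOmegaLimit_of stubFrameSup_holds stubFrameLip_holds (stubClosure_of h₁ h₂)

/-- **StubClosure ⇐ ClosureLaw** (the action half is a theorem). -/
theorem stubClosure_of_law (h : ClosureLaw) : StubClosure := stubClosure_of h closureAction_holds

/-- **StubOmegaLimit ⇐ ClosureLaw.** -/
theorem stubOmegaLimit_of_law (h : ClosureLaw) : StubOmegaLimit :=
  stubOmegaLimit_of stubFrameSup_holds stubFrameLip_holds (stubClosure_of_law h)

end Summit.NavierStokesRegularity.NavierStokesRegularity.Cruxes.MinimalBlowupExtraction.ClockedFrames

end
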